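import Literature.MathematicalPhysics.QuantumFieldTheory.Balaban1983to89.B15AveragingHolomorphic
import HarnessLib

/-!
# (ℓa-C) ROAD B, FILE F4′-1 — COMPLEX GAUGE COVARIANCE OF THE HOLOMORPHIC AVERAGING: `Ū_h(G • V) = (G ∘ emb) • Ū_h(V)` for `SL(N, ℂ)`-valued site maps `G`

Cell `pub-ymgap` ∕ `ym-nodeO-ideate`, porter lineage `ymgap-nodeO-port-PTB-1` (gen 7), hand «(44) for `iterMh`» (director-ym g22 №569/№571; PORT-PLAN-v5 dc7ff9950b0ac185, § F4′-1).
`--kind proof --supports stmt-QuantumFields-27238 --as helper`; count-neutral.  [B7] = [Balaban1985Averaging]; [B11] = [Balaban1985Variational]; [I] = [Balaban1987RG1].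

WHY.  F4′ (k-free polydisc stability of `iterMh` along complex TRACELESS perturbations) runs an induction `V_j = G_j • Ṽ_j` in which the level-`j` complex field is a COMPLEX
gauge transform (`G_j : T^{(j)} → SL(N, ℂ)`, the accumulated «moving frames» of [B7] Sect. B∕D) of a field `Ṽ_j` close to the real tower; the step `j → j+1` needs the (0.6)∕(11)
covariance of the holomorphic averaging `avgMh` of ✓`B15AveragingHolomorphic` under such `G` — print: [B7] (11) «`Ū^u = (Ū)^u`», [I] (0.6) «`M({uU_jv}) = uM({U_j})v`», [B11] p.307
«the equations … are valid for `Gᶜ`-valued fields».  The holomorphic extension takes ADJUGATES on backward steps; on `SL(N, ℂ)` the adjugate IS the inverse, so the telescoping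
of [B7] (8) «`U^u(x,x′) = u(x)U(x,x′)u⁻¹(x′)`» survives VERBATIM for `det G ≡ 1` (and fails off `SL(N,ℂ)`: `adj(G⁻¹) = (det G)⁻¹·G`).  The tree has the GROUP-valued statement
(✓`T4Continuum.holAt_gaugeAct_walk`, ✓`BlockAveraging.avgFun_covariant`) and ▶ PTA-1's `2 × 2` ADJUGATE edition (✓`BalabanUVNodesPortS1JacobianHoloCov.holMh_gauge_walk` … `avgMh_gauge` on
`MatA 2`, `adj adj = id`); this file is the GENERAL-`N` `SL(N,ℂ)`∕inverse edition for `holMh ∕ loopMh ∕ axialMh ∕ corrMh ∕ avgMh ∕ iterMh` (names suffixed `SL`).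
No definition: the complex gauge action is written inline `fun b => G b.src * V b * (G b.tgt)⁻¹`.

WHAT IS PROVED (0 def, 0 sorry, axioms standard; ns `Summit.QuantumFields.YangMills.Theorems.C44IterMh`).
* §1 `SL(N,ℂ)` bookkeeping: `sl_isUnit_det`, `sl_adjugate_eq_inv` (`adj A = A⁻¹`), `sl_det_inv_eq_one`, `sl_adjugate_inv_eq_self`
  (`adj(A⁻¹) = A`), `sl_inv_mul_cancel` ∕ `sl_mul_inv_cancel`.
* §2 ★ `stepMh_gaugeSL_fwd` ∕ `stepMh_gaugeSL_bwd`, ★★ `holMh_gaugeSL_walk` — `holMh (G • V) (walk x w) = G x · holMh V (walk x w) · G(walkEnd x w)⁻¹` ([B7] (8) telescoped, complex edition).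
* §3 ★★ `loopMh_gaugeSL` (closed loops conjugate by `G(emb c₋)`), `axialMh_gaugeSL` (`G(emb c₋) · V([c₋,c₊]) · G(emb c₊)⁻¹`), `corrMh_gaugeSL` (✓`eml_conj`, (0.6)), ★★★ `avgMh_gaugeSL` —
  `avgMh (G • V) c = G(emb c₋) · avgMh V c · G(emb c₊)⁻¹`, i.e. `Ū_h(G • V) = (G ∘ emb) • Ū_h V`; ★★ `iterMh_gaugeSL` — `Ū^k_h(G • V) = (G ∘ embIter k) • Ū^k_h V` (✓`B15DeterminingSets.embIter`).
All statements are IDENTITIES valid for every matrix field `V` (no smallness): `mlog`∕`eml` commute with conjugation term by term (✓`ExpMeanLog.eml_conj`, no guard).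

HONEST FRAMING.  Algebraic identities over DEFINED objects; nothing of [B7] Props 1–3∕7 or [B11] (44) is proved here.  (ℓa-C)(ℓa-H)(ℓd) DISPLAYED; (R1)∕(R2) OPEN; K0ᴬ
⟨stmt-QuantumFields-27238⟩ NOT closed; K0ᴬ∕K1ᴬ∕K3ᴬ 0∕3; NODE O 0∕1; COUNT 8∕28 · K 1∕4 UNMOVED; finite `𝕋⁴_{L^K}` at fixed ε — NOT continuum ∕ ℝ⁴ ∕ OS; **the Yang–Mills mass gap
(Clay) is NOT proved by any of this.**  No `sorry`, `instance`, `notation`, `set_option`; standard axioms.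
-/

noncomputable section

open scoped Matrix Matrix.Norms.L2Operator

namespace Summit.QuantumFields.YangMills.Theorems.C44IterMh

open Literature.MathematicalPhysics.QuantumFieldTheory.Balaban1983to89
open T4Continuum BlockAveraging B15DeterminingSets
open B15AveragingHolomorphic (stepMh holMh holMh_nil holMh_cons loopMh axialMh corrMh avgMh iterMh iterMh_zero iterMh_succ)
open ExpMeanLog (eml eml_conj)

/-! ## §1  `SL(N, ℂ)` bookkeeping: on determinant-one matrices the adjugate is the inverse -/

section SL

variable {N : ℕ}

/-- A determinant-one matrix has invertible determinant. [cite: Balaban1985Variational, p.307 («Gᶜ-valued fields»; bookkeeping)] -/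
theorem sl_isUnit_det {A : Matrix (Fin N) (Fin N) ℂ} (hA : A.det = 1) : IsUnit A.det := by
  rw [hA]; exact isUnit_one

/-- **On `SL(N, ℂ)` the adjugate IS the inverse**: `adj A = A⁻¹` when `det A = 1` (`A⁻¹ = (det A)⁻¹ • adj A`). [cite: Balaban1985Variational, p.307 («Gᶜ-valued fields»; bookkeeping)] -/
theorem sl_adjugate_eq_inv {A : Matrix (Fin N) (Fin N) ℂ} (hA : A.det = 1) : A.adjugate = A⁻¹ := by
  rw [Matrix.inv_def, hA, Ring.inverse_one, one_smul]

/-- The inverse of a determinant-one matrix has determinant one. [cite: Balaban1985Variational, p.307 (bookkeeping)] -/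
theorem sl_det_inv_eq_one {A : Matrix (Fin N) (Fin N) ℂ} (hA : A.det = 1) : (A⁻¹).det = 1 := by
  rw [Matrix.det_nonsing_inv, hA, Ring.inverse_one]

/-- `adj (A⁻¹) = A` when `det A = 1`. [cite: Balaban1985Variational, p.307 (bookkeeping)] -/
theorem sl_adjugate_inv_eq_self {A : Matrix (Fin N) (Fin N) ℂ} (hA : A.det = 1) : (A⁻¹).adjugate = A := by
  rw [sl_adjugate_eq_inv (sl_det_inv_eq_one hA), Matrix.nonsing_inv_nonsing_inv A (sl_isUnit_det hA)]

/-- `A⁻¹ · A = 1` on `SL(N, ℂ)`. [cite: Balaban1985Variational, p.307 (bookkeeping)] -/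
theorem sl_inv_mul_cancel {A : Matrix (Fin N) (Fin N) ℂ} (hA : A.det = 1) : A⁻¹ * A = 1 :=
  Matrix.nonsing_inv_mul A (sl_isUnit_det hA)

/-- `A · A⁻¹ = 1` on `SL(N, ℂ)`. [cite: Balaban1985Variational, p.307 (bookkeeping)] -/
theorem sl_mul_inv_cancel {A : Matrix (Fin N) (Fin N) ℂ} (hA : A.det = 1) : A * A⁻¹ = 1 :=
  Matrix.mul_nonsing_inv A (sl_isUnit_det hA)

end SL

/-! ## §2  The complex gauge action through the holomorphic step matrices and walk products -/

section Walks

variable {P : Params} {j : ℕ} {N : ℕ}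

/-- Forward step of the gauge-transformed field: `G(b₋)·V(b)·G(b₊)⁻¹`. [cite: Balaban1985Averaging, (8) p.18] -/
theorem stepMh_gaugeSL_fwd (G : Site P j → Matrix (Fin N) (Fin N) ℂ) (V : PBond P j → Matrix (Fin N) (Fin N) ℂ) (b : PBond P j) :
    stepMh (fun b => G b.src * V b * (G b.tgt)⁻¹) ⟨b, true⟩ = G b.src * V b * (G b.tgt)⁻¹ := rfl

/-- **Backward step of the gauge-transformed field on `SL(N, ℂ)`**: `adj(G(b₋)·V(b)·G(b₊)⁻¹) = G(b₊)·adj V(b)·G(b₋)⁻¹` (`adj` is anti-multiplicative, `adj(G⁻¹) = G`, `adj G = G⁻¹`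
for `det G = 1`). [cite: Balaban1985Averaging, (8) p.18; Balaban1985Variational, p.307] -/
theorem stepMh_gaugeSL_bwd (G : Site P j → Matrix (Fin N) (Fin N) ℂ) (hG : ∀ x, (G x).det = 1) (V : PBond P j → Matrix (Fin N) (Fin N) ℂ) (b : PBond P j) :
    stepMh (fun b => G b.src * V b * (G b.tgt)⁻¹) ⟨b, false⟩ = G b.tgt * stepMh V ⟨b, false⟩ * (G b.src)⁻¹ := by
  simp only [stepMh, Bool.false_eq_true, ↓reduceIte]
  rw [Matrix.adjugate_mul_distrib, Matrix.adjugate_mul_distrib, sl_adjugate_inv_eq_self (hG b.tgt), sl_adjugate_eq_inv (hG b.src), mul_assoc]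

/-- ★★ **[B7] (8) TELESCOPED, COMPLEX EDITION**: for an `SL(N, ℂ)`-valued site map `G` and ANY matrix field `V`,
`holMh (G • V) (walk x w) = G(x) · holMh V (walk x w) · G(walkEnd x w)⁻¹` (the holomorphic walk product with adjugates on backward steps; the tree's GROUP-valued
✓`holAt_gaugeAct_walk` verbatim once `adj = ⁻¹` on `SL(N,ℂ)`). [cite: Balaban1985Averaging, (8) p.18, (11) p.19; Balaban1985Variational, p.307] -/
theorem holMh_gaugeSL_walk (G : Site P j → Matrix (Fin N) (Fin N) ℂ) (hG : ∀ x, (G x).det = 1) (V : PBond P j → Matrix (Fin N) (Fin N) ℂ) :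
    ∀ (x : Site P j) (w : List (Letter P.d)),
      holMh (fun b => G b.src * V b * (G b.tgt)⁻¹) (walk x w) = G x * holMh V (walk x w) * (G (walkEnd x w))⁻¹
  | x, [] => by
    simp only [walk, walkEnd, holMh_nil, mul_one]
    rw [sl_mul_inv_cancel (hG x)]
  | x, (μ, true) :: w => by
    rw [walk, walkEnd, holMh_cons, holMh_cons, holMh_gaugeSL_walk G hG V (x.shift μ) w, stepMh_gaugeSL_fwd]
    simp only [stepMh, ↓reduceIte, PBond.tgt]
    rw [show G x * V ⟨x, μ⟩ * (G (x.shift μ))⁻¹ * (G (x.shift μ) * holMh V (walk (x.shift μ) w) * (G (walkEnd (x.shift μ) w))⁻¹)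
        = G x * V ⟨x, μ⟩ * ((G (x.shift μ))⁻¹ * G (x.shift μ)) * holMh V (walk (x.shift μ) w) * (G (walkEnd (x.shift μ) w))⁻¹ by simp only [mul_assoc],
      sl_inv_mul_cancel (hG _), mul_one]
    simp only [mul_assoc]
  | x, (μ, false) :: w => by
    have hus : (x.unshift μ).shift μ = x := by
      funext ν
      by_cases h : ν = μ
      · subst h
        simp [Site.shift, Site.unshift]
      · simp [Site.shift_apply, Site.unshift_apply, h]
    rw [walk, walkEnd, holMh_cons, holMh_cons, holMh_gaugeSL_walk G hG V (x.unshift μ) w, stepMh_gaugeSL_bwd G hG V]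
    simp only [PBond.tgt, hus]
    rw [show G x * stepMh V ⟨⟨x.unshift μ, μ⟩, false⟩ * (G (x.unshift μ))⁻¹ *
          (G (x.unshift μ) * holMh V (walk (x.unshift μ) w) * (G (walkEnd (x.unshift μ) w))⁻¹)
        = G x * stepMh V ⟨⟨x.unshift μ, μ⟩, false⟩ * ((G (x.unshift μ))⁻¹ * G (x.unshift μ)) * holMh V (walk (x.unshift μ) w) *
          (G (walkEnd (x.unshift μ) w))⁻¹ by simp only [mul_assoc],
      sl_inv_mul_cancel (hG _), mul_one]
    simp only [mul_assoc]

end Walks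

/-! ## §3  Loops, the straight segment, the `exp[mean log]` correction, the one-step average, the iterate -/

section Average

variable {P : Params} {j : ℕ} {N : ℕ}

/-- ★★ **CLOSED LOOPS CONJUGATE**: `loopMh (G • V) c i = G(emb c₋) · loopMh V c i · G(emb c₋)⁻¹` (the (0.4) loop word has zero net displacement, ✓`netDisp_loopWord`).
[cite: Balaban1987RG1, (0.4) p.253; Balaban1985Averaging, (12) p.19] -/
theorem loopMh_gaugeSL (G : Site P j → Matrix (Fin N) (Fin N) ℂ) (hG : ∀ x, (G x).det = 1) (V : PBond P j → Matrix (Fin N) (Fin N) ℂ) (c : PBond P (j + 1)) (i : Idx P) :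
    loopMh (fun b => G b.src * V b * (G b.tgt)⁻¹) c i = G (emb c.src) * loopMh V c i * (G (emb c.src))⁻¹ := by
  unfold loopMh
  rw [holMh_gaugeSL_walk G hG V, walkEnd_eq_self_of_netDisp]
  intro ν
  rw [netDisp_loopWord, Int.cast_zero]

/-- **THE STRAIGHT SEGMENT**: `axialMh (G • V) c = G(emb c₋) · axialMh V c · G(emb c₊)⁻¹` (the walk of `L` steps from `emb c₋` ends at `emb c₊`, ✓`walkEnd_replicate_L`).
[cite: Balaban1987RG1, (0.4) p.253; Balaban1985Averaging, (8) p.18] -/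
theorem axialMh_gaugeSL (G : Site P j → Matrix (Fin N) (Fin N) ℂ) (hG : ∀ x, (G x).det = 1) (V : PBond P j → Matrix (Fin N) (Fin N) ℂ) (c : PBond P (j + 1)) :
    axialMh (fun b => G b.src * V b * (G b.tgt)⁻¹) c = G (emb c.src) * axialMh V c * (G (emb c.tgt))⁻¹ := by
  unfold axialMh
  rw [holMh_gaugeSL_walk G hG V, walkEnd_replicate_L]
  rfl

/-- **(0.6) FOR THE CORRECTION FACTOR**: `corrMh (G • V) c = G(emb c₋) · corrMh V c · G(emb c₋)⁻¹` (conjugated loops, ✓`eml_conj` — no smallness needed).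
[cite: Balaban1987RG1, (0.6) p.253] -/
theorem corrMh_gaugeSL (G : Site P j → Matrix (Fin N) (Fin N) ℂ) (hG : ∀ x, (G x).det = 1) (V : PBond P j → Matrix (Fin N) (Fin N) ℂ) (c : PBond P (j + 1)) :
    corrMh (fun b => G b.src * V b * (G b.tgt)⁻¹) c = G (emb c.src) * corrMh V c * (G (emb c.src))⁻¹ := by
  unfold corrMh
  have hl : (fun i : Idx P => loopMh (fun b => G b.src * V b * (G b.tgt)⁻¹) c i) = fun i => G (emb c.src) * loopMh V c i * (G (emb c.src))⁻¹ :=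
    funext fun i => loopMh_gaugeSL G hG V c i
  rw [hl, eml_conj (sl_mul_inv_cancel (hG _)) (sl_inv_mul_cancel (hG _))]

/-- ★★★ **COMPLEX GAUGE COVARIANCE OF THE HOLOMORPHIC (0.4) AVERAGING**: `avgMh (G • V) c = G(emb c₋) · avgMh V c · G(emb c₊)⁻¹`, i.e. `Ū_h(G • V) = (G ∘ emb) • Ū_h(V)`, for
every `SL(N, ℂ)`-valued site map `G` and every matrix field `V` — [B7] (11) «`Ū^u = (Ū)^u`» on the complexification ([B11] p.307 «valid for `Gᶜ`-valued fields»).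
[cite: Balaban1985Averaging, (11) p.19; Balaban1987RG1, (0.4) p.253, (0.6) p.253; Balaban1985Variational, p.307] -/
theorem avgMh_gaugeSL (G : Site P j → Matrix (Fin N) (Fin N) ℂ) (hG : ∀ x, (G x).det = 1) (V : PBond P j → Matrix (Fin N) (Fin N) ℂ) (c : PBond P (j + 1)) :
    avgMh (fun b => G b.src * V b * (G b.tgt)⁻¹) c = G (emb c.src) * avgMh V c * (G (emb c.tgt))⁻¹ := by
  show corrMh _ c * axialMh _ c = G (emb c.src) * (corrMh V c * axialMh V c) * (G (emb c.tgt))⁻¹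
  rw [corrMh_gaugeSL G hG V c, axialMh_gaugeSL G hG V c,
    show G (emb c.src) * corrMh V c * (G (emb c.src))⁻¹ * (G (emb c.src) * axialMh V c * (G (emb c.tgt))⁻¹)
      = G (emb c.src) * corrMh V c * ((G (emb c.src))⁻¹ * G (emb c.src)) * axialMh V c * (G (emb c.tgt))⁻¹ by simp only [mul_assoc],
    sl_inv_mul_cancel (hG _), mul_one]
  simp only [mul_assoc]

/-- The same, as an identity of FIELDS on the coarse lattice: `avgMh (G • V) = (G ∘ emb) • avgMh V`. [cite: Balaban1985Averaging, (11) p.19; Balaban1987RG1, (0.6) p.253] -/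
theorem avgMh_gaugeSL_eq (G : Site P j → Matrix (Fin N) (Fin N) ℂ) (hG : ∀ x, (G x).det = 1) (V : PBond P j → Matrix (Fin N) (Fin N) ℂ) :
    avgMh (fun b => G b.src * V b * (G b.tgt)⁻¹) = fun c => G (emb c.src) * avgMh V c * (G (emb c.tgt))⁻¹ :=
  funext fun c => avgMh_gaugeSL G hG V c

/-- ★★ **THE ITERATE**: `Ū^k_h(G • V) = (G ∘ embIter k) • Ū^k_h(V)` for `SL(N, ℂ)`-valued `G` on the finest lattice (✓`B15DeterminingSets.embIter`; induction on `k` with `avgMh_gaugeSL_eq`).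
[cite: Balaban1985Averaging, (11) p.19; Balaban1987RG1, (0.21) p.256] -/
theorem iterMh_gaugeSL (G : Site P 0 → Matrix (Fin N) (Fin N) ℂ) (hG : ∀ x, (G x).det = 1) (V : PBond P 0 → Matrix (Fin N) (Fin N) ℂ) :
    ∀ k : ℕ, iterMh k (fun b => G b.src * V b * (G b.tgt)⁻¹) = fun c => G (embIter k c.src) * iterMh k V c * (G (embIter k c.tgt))⁻¹
  | 0 => rfl
  | k + 1 => by
    rw [iterMh_succ, iterMh_succ, iterMh_gaugeSL G hG V k]
    exact avgMh_gaugeSL_eq (fun y : Site P k => G (embIter k y)) (fun y => hG _) (iterMh k V)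

end Average

end Summit.QuantumFields.YangMills.Theorems.C44IterMh

end
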